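import Summits.Ventures.PackingBounds.SphericalCodes.GhostTwoDistance

/-!
# Ghost exclusions for the ten hunt cells (fractional triangle-free srg parameters, n ≤ 256)

Framing: lottery ticket; floor = certified bounds/negative ranges. Venture `PackingBounds` (cell
`pub-packcert`, recognition seat, T5.md §8 (g)). Instances of
`GhostTwoDistance.no_twoDistance_tightFrame_config` for the cells (130, 2/65) 756, (133, 1/35) 646,
(140, 1/40) 546, (154, 7/286) 651, (165, 1/55) 486, (208, 1/56) 715, (221, 1/85) 546, (230, 1/50) 1127,
(243, 1/81) 640, (250, 1/100) 594: in each, the Bachoc–Vallentin bound is exactly the integer `N`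
(exact certificates `certs/t5/batch/`), and complementary slackness would force a centred tight-frame
two-distance configuration with the listed parameters, which these lemmas exclude by the parity of the
forced exclusive-neighbour count. With `GhostMaster.card_lt_of_tight_twoAtom_certificate` the kernel gap for
each 'A(n, arccos s) ≤ N − 1' is the certificate alone.
-/

open Finset
open scoped RealInnerProductSpace BigOperators

namespace Summit.Ventures.PackingBounds.SphericalCodes

/-- Hunt cell `(n, s) = (130, 2/65)`, `N = 756`, `b = -1/5`, frame constant `c = 378 / 65`; forced exclusive-neighbour
count `q* = 882/5` is not an even integer: no centred tight-frame two-distance configuration (T5.md §8 (g)). -/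
theorem no_ghost_config_130_2_65 {E : Type*} [NormedAddCommGroup E] [InnerProductSpace ℝ E] [DecidableEq E]
    (C : Finset E) (hcard : C.card = 756) (hC : ∀ x ∈ C, ‖x‖ = 1)
    (hval : ∀ x ∈ C, ∀ y ∈ C, x ≠ y → inner ℝ x y = (2 / 65 : ℝ) ∨ inner ℝ x y = (-1 / 5 : ℝ))
    (hcent : ∀ y ∈ C, ∑ x ∈ C, inner ℝ x y = 0)
    (hframe : ∀ v : E, ∑ x ∈ C, (inner ℝ x v) ^ 2 = (378 / 65 : ℝ) * ‖v‖ ^ 2) : False := by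
  refine no_twoDistance_tightFrame_config C (2 / 65) (-1 / 5) (378 / 65) (by norm_num) hC hval hcent hframe
    (by rw [hcard]; norm_num) (by rw [← Finset.card_pos, hcard]; norm_num) ?_
  intro m h
  have h2 : (10 * m : ℝ) = 882 := by nlinarith [h]
  have h3 : (10 * m : ℕ) = 882 := by exact_mod_cast h2
  omega

/-- Hunt cell `(n, s) = (133, 1/35)`, `N = 646`, `b = -1/5`, frame constant `c = 34 / 7`; forced exclusive-neighbour
count `q* = 289/2` is not an even integer: no centred tight-frame two-distance configuration (T5.md §8 (g)). -/
theorem no_ghost_config_133_1_35 {E : Type*} [NormedAddCommGroup E] [InnerProductSpace ℝ E] [DecidableEq E]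
    (C : Finset E) (hcard : C.card = 646) (hC : ∀ x ∈ C, ‖x‖ = 1)
    (hval : ∀ x ∈ C, ∀ y ∈ C, x ≠ y → inner ℝ x y = (1 / 35 : ℝ) ∨ inner ℝ x y = (-1 / 5 : ℝ))
    (hcent : ∀ y ∈ C, ∑ x ∈ C, inner ℝ x y = 0)
    (hframe : ∀ v : E, ∑ x ∈ C, (inner ℝ x v) ^ 2 = (34 / 7 : ℝ) * ‖v‖ ^ 2) : False := by
  refine no_twoDistance_tightFrame_config C (1 / 35) (-1 / 5) (34 / 7) (by norm_num) hC hval hcent hframe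
    (by rw [hcard]; norm_num) (by rw [← Finset.card_pos, hcard]; norm_num) ?_
  intro m h
  have h2 : (4 * m : ℝ) = 289 := by nlinarith [h]
  have h3 : (4 * m : ℕ) = 289 := by exact_mod_cast h2
  omega

/-- Hunt cell `(n, s) = (140, 1/40)`, `N = 546`, `b = -1/5`, frame constant `c = 39 / 10`; forced exclusive-neighbour
count `q* = 338/3` is not an even integer: no centred tight-frame two-distance configuration (T5.md §8 (g)). -/
theorem no_ghost_config_140_1_40 {E : Type*} [NormedAddCommGroup E] [InnerProductSpace ℝ E] [DecidableEq E]
    (C : Finset E) (hcard : C.card = 546) (hC : ∀ x ∈ C, ‖x‖ = 1)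
    (hval : ∀ x ∈ C, ∀ y ∈ C, x ≠ y → inner ℝ x y = (1 / 40 : ℝ) ∨ inner ℝ x y = (-1 / 5 : ℝ))
    (hcent : ∀ y ∈ C, ∑ x ∈ C, inner ℝ x y = 0)
    (hframe : ∀ v : E, ∑ x ∈ C, (inner ℝ x v) ^ 2 = (39 / 10 : ℝ) * ‖v‖ ^ 2) : False := by
  refine no_twoDistance_tightFrame_config C (1 / 40) (-1 / 5) (39 / 10) (by norm_num) hC hval hcent hframe
    (by rw [hcard]; norm_num) (by rw [← Finset.card_pos, hcard]; norm_num) ?_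
  intro m h
  have h2 : (6 * m : ℝ) = 338 := by nlinarith [h]
  have h3 : (6 * m : ℕ) = 338 := by exact_mod_cast h2
  omega

/-- Hunt cell `(n, s) = (154, 7/286)`, `N = 651`, `b = -5/26`, frame constant `c = 93 / 22`; forced exclusive-neighbour
count `q* = 135` is not an even integer: no centred tight-frame two-distance configuration (T5.md §8 (g)). -/
theorem no_ghost_config_154_7_286 {E : Type*} [NormedAddCommGroup E] [InnerProductSpace ℝ E] [DecidableEq E]
    (C : Finset E) (hcard : C.card = 651) (hC : ∀ x ∈ C, ‖x‖ = 1)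
    (hval : ∀ x ∈ C, ∀ y ∈ C, x ≠ y → inner ℝ x y = (7 / 286 : ℝ) ∨ inner ℝ x y = (-5 / 26 : ℝ))
    (hcent : ∀ y ∈ C, ∑ x ∈ C, inner ℝ x y = 0)
    (hframe : ∀ v : E, ∑ x ∈ C, (inner ℝ x v) ^ 2 = (93 / 22 : ℝ) * ‖v‖ ^ 2) : False := by
  refine no_twoDistance_tightFrame_config C (7 / 286) (-5 / 26) (93 / 22) (by norm_num) hC hval hcent hframe
    (by rw [hcard]; norm_num) (by rw [← Finset.card_pos, hcard]; norm_num) ?_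
  intro m h
  have h2 : (2 * m : ℝ) = 135 := by nlinarith [h]
  have h3 : (2 * m : ℕ) = 135 := by exact_mod_cast h2
  omega

/-- Hunt cell `(n, s) = (165, 1/55)`, `N = 486`, `b = -1/5`, frame constant `c = 162 / 55`; forced exclusive-neighbour
count `q* = 81` is not an even integer: no centred tight-frame two-distance configuration (T5.md §8 (g)). -/
theorem no_ghost_config_165_1_55 {E : Type*} [NormedAddCommGroup E] [InnerProductSpace ℝ E] [DecidableEq E]
    (C : Finset E) (hcard : C.card = 486) (hC : ∀ x ∈ C, ‖x‖ = 1)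
    (hval : ∀ x ∈ C, ∀ y ∈ C, x ≠ y → inner ℝ x y = (1 / 55 : ℝ) ∨ inner ℝ x y = (-1 / 5 : ℝ))
    (hcent : ∀ y ∈ C, ∑ x ∈ C, inner ℝ x y = 0)
    (hframe : ∀ v : E, ∑ x ∈ C, (inner ℝ x v) ^ 2 = (162 / 55 : ℝ) * ‖v‖ ^ 2) : False := by
  refine no_twoDistance_tightFrame_config C (1 / 55) (-1 / 5) (162 / 55) (by norm_num) hC hval hcent hframe
    (by rw [hcard]; norm_num) (by rw [← Finset.card_pos, hcard]; norm_num) ?_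
  intro m h
  have h2 : (2 * m : ℝ) = 81 := by nlinarith [h]
  have h3 : (2 * m : ℕ) = 81 := by exact_mod_cast h2
  omega

/-- Hunt cell `(n, s) = (208, 1/56)`, `N = 715`, `b = -5/28`, frame constant `c = 55 / 16`; forced exclusive-neighbour
count `q* = 125` is not an even integer: no centred tight-frame two-distance configuration (T5.md §8 (g)). -/
theorem no_ghost_config_208_1_56 {E : Type*} [NormedAddCommGroup E] [InnerProductSpace ℝ E] [DecidableEq E]
    (C : Finset E) (hcard : C.card = 715) (hC : ∀ x ∈ C, ‖x‖ = 1)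
    (hval : ∀ x ∈ C, ∀ y ∈ C, x ≠ y → inner ℝ x y = (1 / 56 : ℝ) ∨ inner ℝ x y = (-5 / 28 : ℝ))
    (hcent : ∀ y ∈ C, ∑ x ∈ C, inner ℝ x y = 0)
    (hframe : ∀ v : E, ∑ x ∈ C, (inner ℝ x v) ^ 2 = (55 / 16 : ℝ) * ‖v‖ ^ 2) : False := by
  refine no_twoDistance_tightFrame_config C (1 / 56) (-5 / 28) (55 / 16) (by norm_num) hC hval hcent hframe
    (by rw [hcard]; norm_num) (by rw [← Finset.card_pos, hcard]; norm_num) ?_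
  intro m h
  have h2 : (2 * m : ℝ) = 125 := by nlinarith [h]
  have h3 : (2 * m : ℕ) = 125 := by exact_mod_cast h2
  omega

/-- Hunt cell `(n, s) = (221, 1/85)`, `N = 546`, `b = -1/5`, frame constant `c = 42 / 17`; forced exclusive-neighbour
count `q* = 196/3` is not an even integer: no centred tight-frame two-distance configuration (T5.md §8 (g)). -/
theorem no_ghost_config_221_1_85 {E : Type*} [NormedAddCommGroup E] [InnerProductSpace ℝ E] [DecidableEq E]
    (C : Finset E) (hcard : C.card = 546) (hC : ∀ x ∈ C, ‖x‖ = 1)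
    (hval : ∀ x ∈ C, ∀ y ∈ C, x ≠ y → inner ℝ x y = (1 / 85 : ℝ) ∨ inner ℝ x y = (-1 / 5 : ℝ))
    (hcent : ∀ y ∈ C, ∑ x ∈ C, inner ℝ x y = 0)
    (hframe : ∀ v : E, ∑ x ∈ C, (inner ℝ x v) ^ 2 = (42 / 17 : ℝ) * ‖v‖ ^ 2) : False := by
  refine no_twoDistance_tightFrame_config C (1 / 85) (-1 / 5) (42 / 17) (by norm_num) hC hval hcent hframe
    (by rw [hcard]; norm_num) (by rw [← Finset.card_pos, hcard]; norm_num) ?_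
  intro m h
  have h2 : (6 * m : ℝ) = 196 := by nlinarith [h]
  have h3 : (6 * m : ℕ) = 196 := by exact_mod_cast h2
  omega

/-- Hunt cell `(n, s) = (230, 1/50)`, `N = 1127`, `b = -1/6`, frame constant `c = 49 / 10`; forced exclusive-neighbour
count `q* = 441/2` is not an even integer: no centred tight-frame two-distance configuration (T5.md §8 (g)). -/
theorem no_ghost_config_230_1_50 {E : Type*} [NormedAddCommGroup E] [InnerProductSpace ℝ E] [DecidableEq E]
    (C : Finset E) (hcard : C.card = 1127) (hC : ∀ x ∈ C, ‖x‖ = 1)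
    (hval : ∀ x ∈ C, ∀ y ∈ C, x ≠ y → inner ℝ x y = (1 / 50 : ℝ) ∨ inner ℝ x y = (-1 / 6 : ℝ))
    (hcent : ∀ y ∈ C, ∑ x ∈ C, inner ℝ x y = 0)
    (hframe : ∀ v : E, ∑ x ∈ C, (inner ℝ x v) ^ 2 = (49 / 10 : ℝ) * ‖v‖ ^ 2) : False := by
  refine no_twoDistance_tightFrame_config C (1 / 50) (-1 / 6) (49 / 10) (by norm_num) hC hval hcent hframe
    (by rw [hcard]; norm_num) (by rw [← Finset.card_pos, hcard]; norm_num) ?_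
  intro m h
  have h2 : (4 * m : ℝ) = 441 := by nlinarith [h]
  have h3 : (4 * m : ℕ) = 441 := by exact_mod_cast h2
  omega

/-- Hunt cell `(n, s) = (243, 1/81)`, `N = 640`, `b = -5/27`, frame constant `c = 640 / 243`; forced exclusive-neighbour
count `q* = 250/3` is not an even integer: no centred tight-frame two-distance configuration (T5.md §8 (g)). -/
theorem no_ghost_config_243_1_81 {E : Type*} [NormedAddCommGroup E] [InnerProductSpace ℝ E] [DecidableEq E]
    (C : Finset E) (hcard : C.card = 640) (hC : ∀ x ∈ C, ‖x‖ = 1)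
    (hval : ∀ x ∈ C, ∀ y ∈ C, x ≠ y → inner ℝ x y = (1 / 81 : ℝ) ∨ inner ℝ x y = (-5 / 27 : ℝ))
    (hcent : ∀ y ∈ C, ∑ x ∈ C, inner ℝ x y = 0)
    (hframe : ∀ v : E, ∑ x ∈ C, (inner ℝ x v) ^ 2 = (640 / 243 : ℝ) * ‖v‖ ^ 2) : False := by
  refine no_twoDistance_tightFrame_config C (1 / 81) (-5 / 27) (640 / 243) (by norm_num) hC hval hcent hframe
    (by rw [hcard]; norm_num) (by rw [← Finset.card_pos, hcard]; norm_num) ?_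
  intro m h
  have h2 : (6 * m : ℝ) = 250 := by nlinarith [h]
  have h3 : (6 * m : ℕ) = 250 := by exact_mod_cast h2
  omega

/-- Hunt cell `(n, s) = (250, 1/100)`, `N = 594`, `b = -1/5`, frame constant `c = 297 / 125`; forced exclusive-neighbour
count `q* = 2178/35` is not an even integer: no centred tight-frame two-distance configuration (T5.md §8 (g)). -/
theorem no_ghost_config_250_1_100 {E : Type*} [NormedAddCommGroup E] [InnerProductSpace ℝ E] [DecidableEq E]
    (C : Finset E) (hcard : C.card = 594) (hC : ∀ x ∈ C, ‖x‖ = 1)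
    (hval : ∀ x ∈ C, ∀ y ∈ C, x ≠ y → inner ℝ x y = (1 / 100 : ℝ) ∨ inner ℝ x y = (-1 / 5 : ℝ))
    (hcent : ∀ y ∈ C, ∑ x ∈ C, inner ℝ x y = 0)
    (hframe : ∀ v : E, ∑ x ∈ C, (inner ℝ x v) ^ 2 = (297 / 125 : ℝ) * ‖v‖ ^ 2) : False := by
  refine no_twoDistance_tightFrame_config C (1 / 100) (-1 / 5) (297 / 125) (by norm_num) hC hval hcent hframe
    (by rw [hcard]; norm_num) (by rw [← Finset.card_pos, hcard]; norm_num) ?_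
  intro m h
  have h2 : (70 * m : ℝ) = 2178 := by nlinarith [h]
  have h3 : (70 * m : ℕ) = 2178 := by exact_mod_cast h2
  omega

end Summit.Ventures.PackingBounds.SphericalCodes
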